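import Literature.Probability.LatticeModels.LatticeBootstrapFeasible
import Literature.Probability.LatticeModels.CriticalTwoPointLower
import Literature.Probability.LatticeModels.IsingPeierls
import Literature.Probability.LatticeModels.PlusMinusStateGibbs
import Literature.Probability.LatticeModels.SharpnessProofs
import Summits.CriticalPhenomena.Ising3DConformalLimit.Theses.LatticeSDPCertificates
import Summits.CriticalPhenomena.Ising3DConformalLimit.Theorems.LatticeSDPCertificatesCriticalStateFeasibleRP
import HarnessLib

/-!
# Feasibility of the critical plus state for the lattice-bootstrap rows
(route `LatticeSDPCertificates`, item stmt-CriticalPhenomena-5506 `CriticalStateFeasible`)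

`CriticalStateFeasible`: there are window constants `c_w, C_w > 0` such that at every level `L`
some boundary law `ν` makes the level-`L` Gibbs-inside mixture functional
`E(A) = ∫ ⟨σ_A⟩^η_{Λ(L);β_c(3),0} ν(dη)` satisfy the eight hypothesis rows of `CertifiedWindow` and
`E{0,x} = ⟨σ₀σ_x⟩⁺_{β_c}` for `x ≠ 0` in `Λ(L)` (`criticalStateFeasible_proof`, literally the route
decl).

Proof. Take `ν = μ⁺_{β_c}`, the plus state, an infinite-volume Gibbs measure
(`exists_plusMeasure_holds`); by the DLR equations its mixture functional at every level is
`A ↦ ⟨σ_A⟩⁺_{β_c,0} = plusCorr 3 β_c 0 A`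
(`exists_isGibbsMeasure_boundaryLawFunctional_eq_plusCorr`, Friedli–Velenik 2017, eq. (6.12)).
The rows are, by `Iff.rfl`, the tree predicate `LatticeBootstrapFeasible L c_w C_w E`, and for
`E = plusCorr 3 β_c 0` each row is a theorem of the tree
(`exists_latticeBootstrapFeasible_plusCorr`): translation invariance `plusCorr_map_shift`;
hyperoctahedral invariance `plusCorr_map_signedPerm`; reflection positivity in the four mirror
types `plusCorr_criticalBeta_fourMirror_rp` (companion file `…CriticalStateFeasibleRP`);
Griffiths I `plusCorr_nonneg`; Messager–Miracle-Solé `messager_miracleSole_holds` /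
`messager_miracleSole_diag_holds` (pair form via `twoPointPlus_eq_plusCorr_pair`); the Simon
sphere rows `sphereSum_twoPointPlus_criticalBeta_ge_one_of_peierls` with Peierls' theorem
`exists_spontaneousMagnetization_pos_holds` (`8·3·β_c = 24 β_c`, `Λ_n ∖ Λ_{n-1} = sphere 3 n`);
the window `criticalTwoPoint_bounds_holds` at `d = 3` (exponents `-2`, `-1`, sup norm; the upper
constant is enlarged to `max C 1 > 0`). Row 9 is `criticalTwoPoint 3 x = ⟨σ_{{0,x}}⟩⁺_{β_c,0}`.

References: S. Friedli, Y. Velenik, *Statistical Mechanics of Lattice Systems* (CUP 2017), §3.6–3.10,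
§6.2 eq. (6.12), Lemma 10.8; H.-O. Georgii, *Gibbs Measures and Phase Transitions* (2011), Rem. 1.24;
J. Fröhlich, R. Israel, E. H. Lieb, B. Simon, Comm. Math. Phys. 62 (1978); A. Messager,
S. Miracle-Solé, J. Stat. Phys. 17 (1977); G. C. Hegerfeldt, Comm. Math. Phys. 57 (1977); B. Simon,
Comm. Math. Phys. 77 (1980); H. Duminil-Copin, *Lectures on the Ising and Potts models* (2019),
Thm. 4.8. No definitions are introduced.
-/

noncomputable section

open Filter MeasureTheory Finset
open scoped Topology BigOperators
open Literature.Probability.LatticeModels Literature.Probability.Percolation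

namespace Summit.CriticalPhenomena.Ising3DConformalLimit.LatticeSDPCertificatesFeasible

/-- Row 9: the pair values of the plus correlations are the critical two-point function,
`⟨σ_{{0,x}}⟩⁺_{β_c,0} = ⟨σ₀σ_x⟩⁺_{β_c,0}` for `x ≠ 0`. -/
theorem plusCorr_pair_eq_criticalTwoPoint {x : Site 3} (hx : x ≠ 0) :
    plusCorr 3 (criticalBeta 3) 0 {0, x} = criticalTwoPoint 3 x := by
  rw [criticalTwoPoint, twoPointPlus_eq_plusCorr_pair _ hx]

/-- **The eight lattice-bootstrap rows hold for the critical plus correlations `⟨σ_A⟩⁺_{β_c(3),0}`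
at every level, with level-independent window constants**: translation invariance
(`plusCorr_map_shift`), hyperoctahedral invariance (`plusCorr_map_signedPerm`), four-mirror
reflection positivity (`plusCorr_criticalBeta_fourMirror_rp`), Griffiths' first inequality
(`plusCorr_nonneg`), the Messager–Miracle-Solé rows (`messager_miracleSole_holds`,
`messager_miracleSole_diag_holds`), the Simon sphere rows
(`sphereSum_twoPointPlus_criticalBeta_ge_one_of_peierls` with Peierls' theorem) and the power window
(`criticalTwoPoint_bounds_holds`, `d = 3`). -/
theorem exists_latticeBootstrapFeasible_plusCorr :
    ∃ cw Cw : ℝ, 0 < cw ∧ 0 < Cw ∧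
      ∀ L : ℕ, LatticeBootstrapFeasible L cw Cw (plusCorr 3 (criticalBeta 3) 0) := by
  have hβ : 0 ≤ criticalBeta 3 := criticalBeta_nonneg 3
  obtain ⟨cw, C, hcw, hwin⟩ := criticalTwoPoint_bounds_holds (d := 3) (by norm_num)
  refine ⟨cw, max C 1, hcw, lt_max_of_lt_right one_pos, fun L => ⟨?_, ?_, ?_, ?_, ?_, ?_, ?_, ?_⟩⟩
  · -- row 1: translation invariance inside the box (in fact everywhere)
    intro A v _ _
    have h := plusCorr_map_shift (d := 3) hβ 0 A v
    have hs : ⇑(Site.shift v) = (· + v) := funext (Site.shift_apply v)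
    rw [Finset.map_eq_image, Equiv.coe_toEmbedding, hs] at h
    exact h
  · -- row 2: signed coordinate permutations
    intro A π s _
    have h := plusCorr_map_signedPerm (d := 3) π.symm s (criticalBeta 3) 0 A
    have hs : ⇑(Site.signedPerm π.symm s) = fun (x : Site 3) (i : Fin 3) => (s i : ℤ) * x (π i) := by
      funext x i
      simp [Site.signedPerm_apply]
    rw [Finset.map_eq_image, Equiv.coe_toEmbedding, hs] at h
    exact h
  · -- row 3: reflection positivity, four mirror types
    intro θ ℓ hθℓ m A c hA
    exact plusCorr_criticalBeta_fourMirror_rp hθℓ A c fun a p hp => (hA a).2 p hp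
  · -- row 4: Griffiths' first inequality
    intro A _
    exact plusCorr_nonneg hβ le_rfl A
  · -- row 5: Messager–Miracle-Solé along the axes
    intro x i hx hxi _ _
    have hx' : x + Pi.single i 1 ≠ 0 := by
      intro h
      have h1 := congr_fun h i
      simp only [Pi.add_apply, Pi.single_eq_same, Pi.zero_apply] at h1
      omega
    rw [← twoPointPlus_eq_plusCorr_pair _ hx', ← twoPointPlus_eq_plusCorr_pair _ hx]
    exact messager_miracleSole_holds hβ x i hxi
  · -- row 6: Messager–Miracle-Solé away from the diagonals
    intro x i j hij hx hxji _ _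
    have hx' : x + Pi.single i 1 - Pi.single j 1 ≠ 0 := by
      intro h
      have h1 := congr_fun h i
      have h2 := congr_fun h j
      simp only [Pi.add_apply, Pi.sub_apply, Pi.single_eq_same, Pi.zero_apply,
        Pi.single_eq_of_ne hij, Pi.single_eq_of_ne hij.symm] at h1 h2
      omega
    rw [← twoPointPlus_eq_plusCorr_pair _ hx', ← twoPointPlus_eq_plusCorr_pair _ hx]
    exact messager_miracleSole_diag_holds hβ x hij hxji
  · -- row 7: Simon sphere rows
    intro n hn _
    obtain ⟨k, rfl⟩ : ∃ k, n = k + 1 := ⟨n - 1, by omega⟩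
    rw [Nat.add_sub_cancel, ← sphere_succ_eq_sdiff]
    have h := sphereSum_twoPointPlus_criticalBeta_ge_one_of_peierls (d := 3)
      exists_spontaneousMagnetization_pos_holds (by norm_num) (k + 1)
    refine h.trans (le_of_eq (Finset.sum_congr rfl fun y hy => ?_))
    have hy0 : y ≠ 0 := by
      intro h0
      rw [h0, mem_sphere, Site.supNorm_eq_zero_iff.2 rfl] at hy
      omega
    rw [twoPointPlus_eq_plusCorr_pair _ hy0]
    push_cast
    ring
  · -- row 8: the power window `cw ‖x‖⁻² ≤ ⟨σ₀σ_x⟩ ≤ max C 1 ‖x‖⁻¹`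
    intro x _ hx
    obtain ⟨hlo, hhi⟩ := hwin x hx
    rw [← plusCorr_pair_eq_criticalTwoPoint hx] at hlo hhi
    have e2 : (-(((3 : ℕ) : ℝ) - 1)) = -(2 : ℝ) := by norm_num
    have e1 : (-(((3 : ℕ) : ℝ) - 2)) = -(1 : ℝ) := by norm_num
    rw [e2] at hlo
    rw [e1] at hhi
    exact ⟨hlo, hhi.trans (mul_le_mul_of_nonneg_right (le_max_left C 1)
      (Real.rpow_nonneg (norm_nonneg x) _))⟩

end Summit.CriticalPhenomena.Ising3DConformalLimit.LatticeSDPCertificatesFeasible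

namespace Summit.CriticalPhenomena.Ising3DConformalLimit.Theorems

open Summit.CriticalPhenomena.Ising3DConformalLimit.LatticeSDPCertificatesFeasible
open Summit.CriticalPhenomena.Ising3DConformalLimit.Theses.LatticeSDPCertificates

/-- **`CriticalStateFeasible`** (item stmt-CriticalPhenomena-5506, support of route
`LatticeSDPCertificates`): with the window constants of `criticalTwoPoint_bounds_holds` (upper one
enlarged to be positive), at every level `L` the plus state `μ⁺_{β_c(3)}` taken as boundary law makes
the level-`L` mixture functional `A ↦ ∫ ⟨σ_A⟩^η_{Λ(L);β_c,0} dμ⁺(η)` — which by the DLR equations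
is `A ↦ ⟨σ_A⟩⁺_{β_c,0}` (Friedli–Velenik 2017, eq. (6.12)) — satisfy every hypothesis row of
`CertifiedWindow` (translation and hyperoctahedral invariance, four-mirror reflection positivity,
Griffiths I, Messager–Miracle-Solé, Simon sphere rows, power window) and reproduce the critical
two-point function on pairs `{0, x}`, `x ≠ 0`. -/
theorem criticalStateFeasible_proof : CriticalStateFeasible := by
  obtain ⟨cw, Cw, hcw, hCw, hfeas⟩ := exists_latticeBootstrapFeasible_plusCorr
  obtain ⟨μ, hμ, -, hcorr⟩ :=
    exists_isGibbsMeasure_boundaryLawFunctional_eq_plusCorr (d := 3) (criticalBeta_nonneg 3)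
  haveI : IsProbabilityMeasure μ := hμ.isProbabilityMeasure
  refine ⟨cw, Cw, hcw, hCw, fun L => ⟨μ, inferInstance, ?_⟩⟩
  have hE : (fun A : Finset (Site 3) => ∫ η, isingCorr (zdGraph 3) (box 3 L) (criticalBeta 3) 0
      (BoundaryCondition.fixed η) A ∂μ) = plusCorr 3 (criticalBeta 3) 0 :=
    funext fun A => hcorr L A
  rw [hE]
  exact ⟨hfeas L, fun x _ hx => plusCorr_pair_eq_criticalTwoPoint hx⟩

end Summit.CriticalPhenomena.Ising3DConformalLimit.Theorems

end
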